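/-
Copyright (c) 2026. All rights reserved.
Released under Apache 2.0 license as described in the file LICENSE.
Authors: abc-iut cell — seat abc-iut-L6-t15 (gen 3): proof-only companion to `HolomorphicCores`
([AbsTopIII] Prop 2.5), no new definitions.
-/
import Literature.AnabelianGeometry.AbsoluteAnabelian.ParallelogramsPlanarParallel

/-!
# Planar geometry behind [AbsTopIII] Prop 2.5, VI: a closed 4-gon of segments with parallel opposite
sides is a parallelogram

Proof-only companion (no definitions) to `HolomorphicCores.lean`, continuing
`ParallelogramsPlanarParallel`.  The planar lemma behind Prop 2.5 (c) ("pre-∂-parallelograms"):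

* on a line, if `[a, b] ∩ [b, c] = {b}` then `b` lies strictly between `a` and `c`; hence four points
  `V₀, V₁, V₂, V₃` on a line can NOT form a closed 4-gon of non-degenerate segments in which consecutive
  edges meet only at the common vertex;
* consequently, if `[V₀,V₁], [V₁,V₂], [V₂,V₃], [V₃,V₀]` are non-degenerate, consecutive ones meet exactly in
  the common vertex, and opposite ones have proportional directions, then `V₁ - V₀, V₃ - V₀` are
  `ℝ`-independent and `V₂ = V₁ + (V₃ - V₀)`: the 4-gon is the boundary of the non-degenerate parallelogram
  `openParallelogram V₀ (V₁ - V₀) (V₃ - V₀)`.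

Refereed classical mathematics (S. Mochizuki, *Topics in absolute anabelian geometry III*, §2; kurims
pages); nothing here bears on the disputed parts of IUT.
-/

namespace Literature.AnabelianGeometry.AbsoluteAnabelian

open _root_.Complex _root_.Set _root_.Topology _root_.Filter _root_.Metric

noncomputable section

/-! ### Collinear configurations -/

/-- On the real line: if `[a, b] ∩ [b, c] = {b}` (unordered closed intervals, `a ≠ b ≠ c`), then `b` lies
strictly between `a` and `c`. (Auxiliary.) [cite: MochizukiAbsTopIII2015, Proposition 2.5 (proof) pp.55–57] -/
theorem mul_pos_of_uIcc_inter_uIcc_eq_singleton {a b c : ℝ} (hab : a ≠ b) (hbc : b ≠ c)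
    (h : uIcc a b ∩ uIcc b c = {b}) : 0 < (b - a) * (c - b) := by
  by_contra hle
  push Not at hle
  rcases lt_or_gt_of_ne hab with hab' | hab'
  · have hcb : c < b := by
      refine lt_of_le_of_ne ?_ (Ne.symm hbc)
      by_contra h'
      push Not at h'
      nlinarith [mul_pos (sub_pos.2 hab') (sub_pos.2 h')]
    have hm : max a c ∈ uIcc a b ∩ uIcc b c :=
      ⟨mem_uIcc.2 (Or.inl ⟨le_max_left _ _, max_le hab'.le hcb.le⟩),
        mem_uIcc.2 (Or.inr ⟨le_max_right _ _, max_le hab'.le hcb.le⟩)⟩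
    rw [h, mem_singleton_iff] at hm
    exact (max_lt hab' hcb).ne hm
  · have hcb : b < c := by
      refine lt_of_le_of_ne ?_ hbc
      by_contra h'
      push Not at h'
      nlinarith [mul_pos (sub_pos.2 hab') (sub_pos.2 h')]
    have hm : min a c ∈ uIcc a b ∩ uIcc b c :=
      ⟨mem_uIcc.2 (Or.inr ⟨le_min hab'.le hcb.le, min_le_left _ _⟩),
        mem_uIcc.2 (Or.inl ⟨le_min hab'.le hcb.le, min_le_right _ _⟩)⟩
    rw [h, mem_singleton_iff] at hm
    exact (lt_min hab' hcb).ne' hm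

/-- Segments between points of a parametrised line are images of unordered intervals.
(Auxiliary.) [cite: MochizukiAbsTopIII2015, Proposition 2.5 (proof) pp.55–57] -/
theorem segment_lineMap_lineMap (P Q : ℂ) (α β : ℝ) :
    segment ℝ (AffineMap.lineMap P Q α : ℂ) (AffineMap.lineMap P Q β) = AffineMap.lineMap P Q '' uIcc α β := by
  rw [← segment_eq_uIcc, image_segment]

/-- On a line in `ℂ`: if `[g a, g b] ∩ [g b, g c] = {g b}` for an injective parametrisation `g`, then
`0 < (b - a)(c - b)`. (Auxiliary.) [cite: MochizukiAbsTopIII2015, Proposition 2.5 (proof) pp.55–57] -/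
theorem mul_pos_of_segment_inter_eq_singleton {P Q : ℂ} (hPQ : P ≠ Q) {a b c : ℝ} (hab : a ≠ b)
    (hbc : b ≠ c)
    (h : segment ℝ (AffineMap.lineMap P Q a : ℂ) (AffineMap.lineMap P Q b) ∩
      segment ℝ (AffineMap.lineMap P Q b : ℂ) (AffineMap.lineMap P Q c) = {(AffineMap.lineMap P Q b : ℂ)}) :
    0 < (b - a) * (c - b) := by
  have hinj := lineMap_injective_complex hPQ
  rw [segment_lineMap_lineMap, segment_lineMap_lineMap, ← image_inter hinj, ← image_singleton,
    (image_injective.2 hinj).eq_iff] at h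
  exact mul_pos_of_uIcc_inter_uIcc_eq_singleton hab hbc h

/-- Four points on a line in `ℂ` cannot form a closed 4-gon of non-degenerate segments whose consecutive
edges meet only at the common vertex. (Auxiliary.) [cite: MochizukiAbsTopIII2015, Proposition 2.5 (proof) pp.55–57] -/
theorem not_collinear_closed_fourgon {P Q : ℂ} (hPQ : P ≠ Q) {τ₀ τ₁ τ₂ τ₃ : ℝ} (h01 : τ₀ ≠ τ₁)
    (h12 : τ₁ ≠ τ₂) (h23 : τ₂ ≠ τ₃) (h30 : τ₃ ≠ τ₀)
    (hA1 : segment ℝ (AffineMap.lineMap P Q τ₀ : ℂ) (AffineMap.lineMap P Q τ₁) ∩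
      segment ℝ (AffineMap.lineMap P Q τ₁ : ℂ) (AffineMap.lineMap P Q τ₂) = {(AffineMap.lineMap P Q τ₁ : ℂ)})
    (hA2 : segment ℝ (AffineMap.lineMap P Q τ₁ : ℂ) (AffineMap.lineMap P Q τ₂) ∩
      segment ℝ (AffineMap.lineMap P Q τ₂ : ℂ) (AffineMap.lineMap P Q τ₃) = {(AffineMap.lineMap P Q τ₂ : ℂ)})
    (hA3 : segment ℝ (AffineMap.lineMap P Q τ₂ : ℂ) (AffineMap.lineMap P Q τ₃) ∩
      segment ℝ (AffineMap.lineMap P Q τ₃ : ℂ) (AffineMap.lineMap P Q τ₀) = {(AffineMap.lineMap P Q τ₃ : ℂ)}) :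
    False := by
  have h1 := mul_pos_of_segment_inter_eq_singleton hPQ h01 h12 hA1
  have h2 := mul_pos_of_segment_inter_eq_singleton hPQ h12 h23 hA2
  have h3 := mul_pos_of_segment_inter_eq_singleton hPQ h23 h30 hA3
  rcases pos_and_pos_or_neg_and_neg_of_mul_pos h1 with ⟨h1a, h1b⟩ | ⟨h1a, h1b⟩ <;>
    rcases pos_and_pos_or_neg_and_neg_of_mul_pos h2 with ⟨h2a, h2b⟩ | ⟨h2a, h2b⟩ <;>
    rcases pos_and_pos_or_neg_and_neg_of_mul_pos h3 with ⟨h3a, h3b⟩ | ⟨h3a, h3b⟩ <;>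
    linarith

/-! ### The 4-gon lemma -/

/-- **Prop 2.5 (c)**, the planar lemma: four non-degenerate segments `[V₀,V₁], [V₁,V₂], [V₂,V₃], [V₃,V₀]`
in `ℂ` such that consecutive ones meet exactly in the common vertex and opposite ones have proportional
direction vectors bound a non-degenerate parallelogram: `V₁ - V₀, V₃ - V₀` are `ℝ`-independent and
`V₂ = V₁ + (V₃ - V₀)`. [cite: MochizukiAbsTopIII2015, Proposition 2.5 (c) p.56] -/
theorem fourgon_parallelogram {V₀ V₁ V₂ V₃ : ℂ} (h01 : V₀ ≠ V₁) (h12 : V₁ ≠ V₂) (h23 : V₂ ≠ V₃)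
    (h30 : V₃ ≠ V₀) (hpar : ∃ r : ℝ, V₃ - V₂ = (r : ℂ) * (V₁ - V₀))
    (hpar' : ∃ r : ℝ, V₀ - V₃ = (r : ℂ) * (V₂ - V₁))
    (hA1 : segment ℝ V₀ V₁ ∩ segment ℝ V₁ V₂ = {V₁}) (hA2 : segment ℝ V₁ V₂ ∩ segment ℝ V₂ V₃ = {V₂})
    (hA3 : segment ℝ V₂ V₃ ∩ segment ℝ V₃ V₀ = {V₃}) :
    LinearIndependent ℝ ![V₁ - V₀, V₃ - V₀] ∧ V₂ = V₁ + (V₃ - V₀) := by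
  obtain ⟨r, hr⟩ := hpar
  obtain ⟨r', hr'⟩ := hpar'
  have hloop : ((1 + r : ℝ) : ℂ) * (V₁ - V₀) + ((1 + r' : ℝ) : ℂ) * (V₂ - V₁) = 0 := by
    push_cast
    linear_combination (-1 : ℂ) * hr - hr'
  by_cases hli : LinearIndependent ℝ ![V₁ - V₀, V₂ - V₁]
  · -- genuine parallelogram
    have h := (LinearIndependent.pair_iff.1 hli) (1 + r) (1 + r') (by
      rw [Complex.real_smul, Complex.real_smul]; exact hloop)
    have hr1 : r = -1 := by linarith [h.1]
    have hV₂ : V₂ = V₁ + (V₃ - V₀) := by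
      rw [hr1] at hr; push_cast at hr; linear_combination -hr
    refine ⟨?_, hV₂⟩
    have : V₃ - V₀ = V₂ - V₁ := by rw [hV₂]; ring
    rw [this]; exact hli
  · -- collinear case: impossible
    exfalso
    rw [LinearIndependent.pair_iff] at hli
    push Not at hli
    obtain ⟨s, t, hst, hst0⟩ := hli
    rw [Complex.real_smul, Complex.real_smul] at hst
    have hv : V₁ - V₀ ≠ 0 := sub_ne_zero.2 (Ne.symm h01)
    have ht : t ≠ 0 := by
      intro ht
      rw [ht, Complex.ofReal_zero, zero_mul, add_zero] at hst
      have hs : s = 0 := by exact_mod_cast (mul_eq_zero.1 hst).resolve_right hv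
      exact hst0 hs ht
    -- parametrise the line through V₀, V₁
    set μ : ℝ := -s / t with hμ
    have hV₂ : V₂ = V₁ + (μ : ℂ) * (V₁ - V₀) := by
      have htC : (t : ℂ) ≠ 0 := by exact_mod_cast ht
      rw [hμ]; push_cast; field_simp; linear_combination hst
    have hg : ∀ τ : ℝ, (AffineMap.lineMap V₀ V₁ τ : ℂ) = V₀ + (τ : ℂ) * (V₁ - V₀) := lineMap_apply_complex V₀ V₁
    have e0 : V₀ = AffineMap.lineMap V₀ V₁ (0 : ℝ) := by rw [hg]; push_cast; ring
    have e1 : V₁ = AffineMap.lineMap V₀ V₁ (1 : ℝ) := by rw [hg]; push_cast; ring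
    have e2 : V₂ = AffineMap.lineMap V₀ V₁ (1 + μ : ℝ) := by rw [hg, hV₂]; push_cast; ring
    have e3 : V₃ = AffineMap.lineMap V₀ V₁ (1 + μ + r : ℝ) := by
      rw [hg]; push_cast
      linear_combination hr + hV₂
    have h12' : (1 : ℝ) ≠ 1 + μ := by
      intro h0; apply h12; rw [hV₂, show μ = 0 by linarith]; push_cast; ring
    have h23' : (1 + μ : ℝ) ≠ 1 + μ + r := by
      intro h0; apply h23
      rw [show r = 0 by linarith] at hr; push_cast at hr
      linear_combination -hr
    have h30' : (1 + μ + r : ℝ) ≠ 0 := by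
      intro h0; apply h30; rw [e3, h0]; exact e0.symm
    refine not_collinear_closed_fourgon h01 zero_ne_one h12' h23' h30' ?_ ?_ ?_
    · rw [← e0, ← e1, ← e2]; exact hA1
    · rw [← e1, ← e2, ← e3]; exact hA2
    · rw [← e0, ← e2, ← e3]; exact hA3

/-! ### Prop 2.5 (c): recovered parallelograms are genuine parallelograms -/

/-- **Prop 2.5 (c)**: for an open `U ⊆ ℂ` and `𝒮(U) ⊆ 𝒬 ⊆ 𝒫(U)`, every member of the RECOVERED collection
`Parallelograms.parallelograms 𝒬` — the interior of the pre-parallelogram of a pre-∂-parallelogram — is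
(the trace on `U` of) a genuine non-degenerate open parallelogram with closure in `U`, i.e. a member of
`𝒫(U)`. [cite: MochizukiAbsTopIII2015, Proposition 2.5 (c) p.56] -/
theorem Parallelograms.image_val_mem_parallelogramsIn_of_mem {U : Set ℂ} (hU : IsOpen U)
    {𝒬 : Set (Set U)} (h𝒬 : ∀ Q ∈ 𝒬, Subtype.val '' Q ∈ parallelogramsIn U)
    (h𝒮 : ∀ Q : Set U, Subtype.val '' Q ∈ squaresIn U → Q ∈ 𝒬) {P : Set U}
    (hP : P ∈ Parallelograms.parallelograms 𝒬) : Subtype.val '' P ∈ parallelogramsIn U := by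
  obtain ⟨L, ⟨h1, h2, h3, h4⟩, rfl⟩ := hP
  have hseg := fun i => (h1 i).exists_eq_segment_of_subset hU h𝒬 h𝒮
  choose p q hpq hL using hseg
  choose x hx using fun i => (h4 i).2
  have hxmem : ∀ i, x i ∈ L i ∩ L (i + 1) := fun i => by rw [hx i]; rfl
  have hxend : ∀ i, x i ∈ Parallelograms.endpoints 𝒬 (L i) ∩ Parallelograms.endpoints 𝒬 (L (i + 1)) :=
    fun i => (h4 i).1 ▸ hxmem i
  have hends : ∀ i (y : U), y ∈ Parallelograms.endpoints 𝒬 (L i) → (y : ℂ) = p i ∨ (y : ℂ) = q i := by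
    intro i y hy
    have hy' : (y : ℂ) ∈ Subtype.val '' Parallelograms.endpoints 𝒬 (L i) := mem_image_of_mem _ hy
    rw [Parallelograms.image_val_endpoints_eq_of_subset hU h𝒬 h𝒮 (hpq i) (hL i)] at hy'
    simpa using hy'
  -- consecutive vertices are distinct
  have hxne : ∀ i, (x (i - 1) : ℂ) ≠ x i := by
    intro i heq
    have heq' : x (i - 1) = x i := Subtype.ext heq
    have hm1 := (hxmem (i - 1)).1
    have hm2 := (hxmem i).2
    have hempty := (h3 (i - 1)).2
    rw [show i - 1 + 2 = i + 1 by ring] at hempty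
    rw [heq'] at hm1
    have : x i ∈ L (i - 1) ∩ L (i + 1) := ⟨hm1, hm2⟩
    rw [hempty] at this
    exact this
  -- the edges are the segments between consecutive vertices
  have hLx : ∀ i, Subtype.val '' L i = segment ℝ (x (i - 1) : ℂ) (x i) := by
    intro i
    have ha := hends i (x (i - 1)) (by
      have := (hxend (i - 1)).2; rwa [show i - 1 + 1 = i by ring] at this)
    have hb := hends i (x i) (hxend i).1
    rw [hL i]
    rcases ha with ha | ha <;> rcases hb with hb | hb
    · exact absurd (ha.trans hb.symm) (hxne i)
    · rw [← ha, ← hb]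
    · rw [← ha, ← hb, segment_symm]
    · exact absurd (ha.trans hb.symm) (hxne i)
  have hadj : ∀ i, segment ℝ (x (i - 1) : ℂ) (x i) ∩ segment ℝ (x i : ℂ) (x (i + 1)) = {(x i : ℂ)} := by
    intro i
    have e2 := hLx (i + 1)
    rw [show i + 1 - 1 = i by ring] at e2
    rw [← hLx i, ← e2, ← image_inter Subtype.val_injective, hx i, image_singleton]
  -- the vertices `V₀ = x 3, V₁ = x 0, V₂ = x 1, V₃ = x 2`
  have hL0 := hLx 0; rw [show (0 : ZMod 4) - 1 = 3 by decide] at hL0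
  have hL1 := hLx 1; rw [show (1 : ZMod 4) - 1 = 0 by decide] at hL1
  have hL2 := hLx 2; rw [show (2 : ZMod 4) - 1 = 1 by decide] at hL2
  have hL3 := hLx 3; rw [show (3 : ZMod 4) - 1 = 2 by decide] at hL3
  have hA1 := hadj 0
  rw [show (0 : ZMod 4) - 1 = 3 by decide, show (0 : ZMod 4) + 1 = 1 by decide] at hA1
  have hA2 := hadj 1
  rw [show (1 : ZMod 4) - 1 = 0 by decide, show (1 : ZMod 4) + 1 = 2 by decide] at hA2
  have hA3 := hadj 2
  rw [show (2 : ZMod 4) - 1 = 1 by decide, show (2 : ZMod 4) + 1 = 3 by decide] at hA3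
  have h01 := hxne 0; rw [show (0 : ZMod 4) - 1 = 3 by decide] at h01
  have h12 := hxne 1; rw [show (1 : ZMod 4) - 1 = 0 by decide] at h12
  have h23 := hxne 2; rw [show (2 : ZMod 4) - 1 = 1 by decide] at h23
  have h30 := hxne 3; rw [show (3 : ZMod 4) - 1 = 2 by decide] at h30
  have hpar02 := (h3 0).1; rw [show (0 : ZMod 4) + 2 = 2 by decide] at hpar02
  have hpar13 := (h3 1).1; rw [show (1 : ZMod 4) + 2 = 3 by decide] at hpar13
  obtain ⟨hvw, hV₂⟩ := fourgon_parallelogram h01 h12 h23 h30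
    (Parallelograms.Parallel.exists_sub_eq_mul hU h𝒬 h𝒮 hpar02 h01 hL0 hL2)
    (Parallelograms.Parallel.exists_sub_eq_mul hU h𝒬 h𝒮 hpar13 h12 hL1 hL3) hA1 hA2 hA3
  obtain ⟨V₀, hV₀⟩ : ∃ V₀ : ℂ, V₀ = (x 3 : ℂ) := ⟨_, rfl⟩
  obtain ⟨v, hv⟩ : ∃ v : ℂ, v = (x 0 : ℂ) - x 3 := ⟨_, rfl⟩
  obtain ⟨w, hw⟩ : ∃ w : ℂ, w = (x 2 : ℂ) - x 3 := ⟨_, rfl⟩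
  rw [← hv, ← hw] at hvw
  rw [← hw] at hV₂
  rw [← hV₀] at hv hw
  have hv0 : v ≠ 0 := by simpa using hvw.ne_zero 0
  -- chords through the closed parallelogram, with ends on `L 3` and `L 1`
  have chord : ∀ s t : ℝ, 0 ≤ s → s ≤ 1 → 0 ≤ t → t ≤ 1 → ∃ b₁ b₂ : U, b₁ ∈ L 3 ∧ b₂ ∈ L 1 ∧
      (b₁ : ℂ) ≠ b₂ ∧ segment ℝ (b₁ : ℂ) b₂ ⊆ U ∧
        V₀ + (s : ℂ) * v + (t : ℂ) * w ∈ segment ℝ (b₁ : ℂ) b₂ := by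
    intro s t hs hs1 ht ht1
    have hb₁ : V₀ + (t : ℂ) * w ∈ Subtype.val '' L 3 := by
      rw [hL3]
      exact mem_segment_of_eq_add_mul (μ := 1 - t) (by linarith) (by linarith)
        (by rw [hw, hV₀]; push_cast; ring)
    have hb₂ : V₀ + (t : ℂ) * w + v ∈ Subtype.val '' L 1 := by
      rw [hL1]
      exact mem_segment_of_eq_add_mul (μ := t) ht ht1 (by rw [hV₂, hv, hV₀]; ring)
    obtain ⟨b₁, hb₁L, hb₁e⟩ := hb₁
    obtain ⟨b₂, hb₂L, hb₂e⟩ := hb₂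
    have hne : (b₁ : ℂ) ≠ b₂ := by
      rw [hb₁e, hb₂e]; intro h; apply hv0; linear_combination -h
    obtain ⟨M, hM, hMend⟩ := h2 b₁ b₂ (mem_iUnion.2 ⟨3, hb₁L⟩) (mem_iUnion.2 ⟨1, hb₂L⟩)
      (fun h => hne (congrArg Subtype.val h))
    obtain ⟨c, d, hcd, hMcd⟩ := hM.exists_eq_segment_of_subset hU h𝒬 h𝒮
    have hends' := Parallelograms.image_val_endpoints_eq_of_subset hU h𝒬 h𝒮 hcd hMcd
    rw [hMend, image_pair] at hends'
    have hsegeq : segment ℝ c d = segment ℝ (b₁ : ℂ) b₂ := by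
      rcases pair_eq_pair_iff.1 hends'.symm with ⟨h1, h2⟩ | ⟨h1, h2⟩
      · rw [h1, h2]
      · rw [h1, h2, segment_symm]
    refine ⟨b₁, b₂, hb₁L, hb₂L, hne, ?_, ?_⟩
    · rw [← hsegeq, ← hMcd]; exact Subtype.coe_image_subset U M
    · rw [hb₁e, hb₂e]
      exact mem_segment_of_eq_add_mul (μ := s) hs hs1 (by ring)
  have hKU : closure (openParallelogram V₀ v w) ⊆ U := by
    intro y hy
    rw [mem_closure_openParallelogram_iff hvw] at hy
    obtain ⟨s, t, hs, hs1, ht, ht1, rfl⟩ := hy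
    obtain ⟨b₁, b₂, -, -, -, hsub, hy⟩ := chord s t hs hs1 ht ht1
    exact hsub hy
  -- every vertex, hence every edge, lies in the closed parallelogram
  have hcl := fun s t (hs : (0:ℝ) ≤ s) (hs1 : s ≤ 1) (ht : (0:ℝ) ≤ t) (ht1 : t ≤ 1) =>
    (mem_closure_openParallelogram_iff hvw (x := V₀ + (s : ℂ) * v + (t : ℂ) * w)).2
      ⟨s, t, hs, hs1, ht, ht1, rfl⟩
  have hx3 : (x 3 : ℂ) ∈ closure (openParallelogram V₀ v w) := by
    have e : (x 3 : ℂ) = V₀ + ((0:ℝ) : ℂ) * v + ((0:ℝ) : ℂ) * w := by rw [hV₀]; push_cast; ring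
    rw [e]; exact hcl 0 0 le_rfl zero_le_one le_rfl zero_le_one
  have hx0 : (x 0 : ℂ) ∈ closure (openParallelogram V₀ v w) := by
    have e : (x 0 : ℂ) = V₀ + ((1:ℝ) : ℂ) * v + ((0:ℝ) : ℂ) * w := by rw [hv, hV₀]; push_cast; ring
    rw [e]; exact hcl 1 0 zero_le_one le_rfl le_rfl zero_le_one
  have hx1 : (x 1 : ℂ) ∈ closure (openParallelogram V₀ v w) := by
    have e : (x 1 : ℂ) = V₀ + ((1:ℝ) : ℂ) * v + ((1:ℝ) : ℂ) * w := by
      rw [hV₂, hv, hV₀]; push_cast; ring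
    rw [e]; exact hcl 1 1 zero_le_one le_rfl zero_le_one le_rfl
  have hx2 : (x 2 : ℂ) ∈ closure (openParallelogram V₀ v w) := by
    have e : (x 2 : ℂ) = V₀ + ((0:ℝ) : ℂ) * v + ((1:ℝ) : ℂ) * w := by rw [hw, hV₀]; push_cast; ring
    rw [e]; exact hcl 0 1 le_rfl zero_le_one zero_le_one le_rfl
  have hvert : ∀ i, (x i : ℂ) ∈ closure (openParallelogram V₀ v w) := by
    intro i
    rcases (show i = 0 ∨ i = 1 ∨ i = 2 ∨ i = 3 by revert i; decide) with rfl | rfl | rfl | rfl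
    exacts [hx0, hx1, hx2, hx3]
  have hedge : ∀ i, Subtype.val '' L i ⊆ closure (openParallelogram V₀ v w) := fun i => by
    rw [hLx i]
    exact (convex_closure_openParallelogram _ _ _).segment_subset (hvert _) (hvert _)
  -- the pre-parallelogram is the closed parallelogram
  have hpre : Subtype.val '' ⋃₀ {M : Set U | Parallelograms.IsLineSegment 𝒬 M ∧
      Parallelograms.endpoints 𝒬 M ⊆ ⋃ i, L i} = closure (openParallelogram V₀ v w) := by
    apply Subset.antisymm
    · rintro _ ⟨y, ⟨M, ⟨hM, hMe⟩, hyM⟩, rfl⟩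
      obtain ⟨c, d, hcd, hMcd⟩ := hM.exists_eq_segment_of_subset hU h𝒬 h𝒮
      have hends' := Parallelograms.image_val_endpoints_eq_of_subset hU h𝒬 h𝒮 hcd hMcd
      have hcdK : ({c, d} : Set ℂ) ⊆ closure (openParallelogram V₀ v w) := by
        rw [← hends']
        rintro _ ⟨e, he, rfl⟩
        obtain ⟨i, hi⟩ := mem_iUnion.1 (hMe he)
        exact hedge i (mem_image_of_mem _ hi)
      have hyM' : (y : ℂ) ∈ segment ℝ c d := hMcd ▸ mem_image_of_mem _ hyM
      exact (convex_closure_openParallelogram _ _ _).segment_subset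
        (hcdK (mem_insert _ _)) (hcdK (mem_insert_of_mem _ rfl)) hyM'
    · intro y hy
      rw [mem_closure_openParallelogram_iff hvw] at hy
      obtain ⟨s, t, hs, hs1, ht, ht1, rfl⟩ := hy
      obtain ⟨b₁, b₂, hb₁L, hb₂L, hne, hsub, hy⟩ := chord s t hs hs1 ht ht1
      have hyU : V₀ + (s : ℂ) * v + (t : ℂ) * w ∈ U := hsub hy
      refine ⟨⟨_, hyU⟩, ⟨Subtype.val ⁻¹' segment ℝ (b₁ : ℂ) b₂, ⟨?_, ?_⟩, hy⟩, rfl⟩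
      · exact Parallelograms.isLineSegment_of_segment_subset hU h𝒬 h𝒮 hne hsub
      · have himg : Subtype.val '' (Subtype.val ⁻¹' segment ℝ (b₁ : ℂ) b₂ : Set U) =
            segment ℝ (b₁ : ℂ) b₂ := by
          rw [image_preimage_eq_inter_range, Subtype.range_coe, inter_eq_left.2 hsub]
        rw [Parallelograms.endpoints_eq_of_subset hU h𝒬 h𝒮 hne himg]
        rintro e ⟨-, he⟩
        simp only [mem_preimage, mem_insert_iff, mem_singleton_iff] at he
        rcases he with he | he
        · exact mem_iUnion.2 ⟨3, by rwa [show e = b₁ from Subtype.ext he]⟩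
        · exact mem_iUnion.2 ⟨1, by rwa [show e = b₂ from Subtype.ext he]⟩
  -- conclusion: the interior (in `U`) of the pre-parallelogram is the open parallelogram
  rw [Parallelograms.topology_eq_of_subset hU h𝒬 h𝒮]
  have hPi : ⋃₀ {M : Set U | Parallelograms.IsLineSegment 𝒬 M ∧ Parallelograms.endpoints 𝒬 M ⊆ ⋃ i, L i} =
      Subtype.val ⁻¹' closure (openParallelogram V₀ v w) := by
    rw [← hpre, preimage_image_eq _ Subtype.val_injective]
  rw [hPi, ← (hU.isOpenMap_subtype_val).preimage_interior_eq_interior_preimage continuous_subtype_val,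
    interior_closure_openParallelogram hvw, image_preimage_eq_inter_range, Subtype.range_coe,
    inter_eq_left.2 (subset_closure.trans hKU)]
  exact ⟨V₀, v, w, hvw, rfl, hKU⟩

/-- **Prop 2.5 (c)**, set form: `Parallelograms.parallelograms 𝒬 ⊆ {P | val '' P ∈ 𝒫(U)}` for any
`𝒮(U) ⊆ 𝒬 ⊆ 𝒫(U)`. [cite: MochizukiAbsTopIII2015, Proposition 2.5 (c) p.56] -/
theorem Parallelograms.parallelograms_subset_of_subset {U : Set ℂ} (hU : IsOpen U) {𝒬 : Set (Set U)}
    (h𝒬 : ∀ Q ∈ 𝒬, Subtype.val '' Q ∈ parallelogramsIn U)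
    (h𝒮 : ∀ Q : Set U, Subtype.val '' Q ∈ squaresIn U → Q ∈ 𝒬) :
    Parallelograms.parallelograms 𝒬 ⊆ {P : Set U | Subtype.val '' P ∈ parallelogramsIn U} :=
  fun _ hP => Parallelograms.image_val_mem_parallelogramsIn_of_mem hU h𝒬 h𝒮 hP

end

end Literature.AnabelianGeometry.AbsoluteAnabelian
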